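import Summits.Ventures.HodgeRepro2.T5SU11JacobiThreeFour
import Summits.Ventures.HodgeRepro2.T5SU11AbelConstInteger

/-!
# The Jacobi transforms of the integer-weight coefficient moduli are trigonometric-rational:
`m̂_{2j+1}(λ) = Q_j(λ)/cos(πλ/2)`, `m̂_{2j}(λ) = R_j(λ)/sin(πλ/2)` with polynomial `Q_j`, `R_j`

The Gamma quotient of `T5SU11JacobiTransform` at an integer weight `k` is reduced by the Pochhammer
identity `Γ(x + n) = (∏_{i<n} (x + i)) Γ(x)` (`Gamma_add_nat`) to a single product `Γ(z)Γ(1 − z)`, which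
Euler's reflection formula evaluates: for **odd** weights `k = 2j + 1`
(`integral_orbit_rpow_odd_mul_sph`)
`∫_G (1 − |g·0|²)^{k/2} φ_λ dν = 2^{k−2} C_k/(k−2)! · π ∏_{i<j}((1−λ)/2 + i) ∏_{i<j−1}((1+λ)/2 + i) / cos(πλ/2)`
on the strip `2 − k < λ < k` away from the zeros of the cosine, and for **even** weights `k = 2j`
(`integral_orbit_rpow_even_mul_sph`)
`∫_G (1 − |g·0|²)^{k/2} φ_λ dν = 2^{k−2} C_k/(k−2)! · π ∏_{i<j−1}(1 − λ/2 + i) ∏_{i<j−1}(λ/2 + i) / sin(πλ/2)`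
away from the zeros of the sine, with the explicit Abel constants of `T5SU11AbelConstInteger`. The
multiplied form `m̂_{2j+1}(λ) cos(πλ/2) = Q_j(λ)` holds on the WHOLE strip, the zeros of the cosine being
zeros of `Q_j` (`integral_orbit_rpow_odd_mul_sph_mul_cos`). Instances: weight 5,
**`m̂_5(λ) = 2π(1 − λ)(1 + λ)(3 − λ)/(9 cos(πλ/2))`** (`integral_orbit_rpow_five_mul_sph`; `2π/3` at `λ = 0`,
agreeing with `integral_orbit_rpow_nu`), and weight 6,
**`m̂_6(λ) = π² λ(2 − λ)(2 + λ)(4 − λ)/(64 sin(πλ/2))`** (`integral_orbit_rpow_six_mul_sph`; `9π²/64` at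
`λ = 1`, agreeing with `integral_orbit_rpow_six_mul_sph_one`); at `j = 1, 2` the general forms reproduce
`T5SU11JacobiThreeFour`. Nothing is claimed about (N).

Blind lane: Mathlib + the HodgeRepro2 prefix only; no sorry; axioms ⊆ {propext, Classical.choice,
Quot.sound}.
-/

namespace Summit.Ventures.HodgeRepro2.T5SU11JacobiIntegerWeight

open MeasureTheory MeasureTheory.Measure Metric Set Filter Topology
open T5SU11Unimodular T5SU11Fibration T5SU11Cartan T5HaarCircle T5BergmanCoefficient
  T5SU11FibrationHaar T5SU11SphericalFunction T5SU11JacobiIwasawa T5SU11JacobiTransform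
  T5SU11SphericalSymmetry T5SU11XiTransform T5SU11JacobiThreeFour T5SU11AbelConstInteger
open scoped Real Nat

/-! ### The Pochhammer identity and the zeros of `cos(πλ/2)`, `sin(πλ/2)` -/

/-- **Pochhammer**: `Γ(x + n) = (∏_{i<n} (x + i)) Γ(x)` when no `x + i` (`i < n`) vanishes. -/
theorem Gamma_add_nat (x : ℝ) (n : ℕ) (hx : ∀ i : ℕ, i < n → x + i ≠ 0) :
    Real.Gamma (x + n) = (∏ i ∈ Finset.range n, (x + i)) * Real.Gamma x := by
  induction n with
  | zero => simp
  | succ n ih =>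
    have h := ih (fun i hi => hx i (by omega))
    rw [Nat.cast_succ, ← add_assoc, Real.Gamma_add_one (hx n (Nat.lt_succ_self n)), h,
      Finset.prod_range_succ]
    ring

/-- `cos(π(2n + 1)/2) = 0`. -/
lemma cos_pi_mul_odd_div_two (n : ℤ) : Real.cos (π * (2 * n + 1) / 2) = 0 := by
  rw [show π * (2 * n + 1) / 2 = n * π + π / 2 by ring, Real.cos_add_pi_div_two, Real.sin_int_mul_pi,
    neg_zero]

/-- `sin(π(2n)/2) = 0`. -/
lemma sin_pi_mul_even_div_two (n : ℤ) : Real.sin (π * (2 * n) / 2) = 0 := by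
  rw [show π * (2 * n) / 2 = n * π by ring, Real.sin_int_mul_pi]

/-- `(1 − λ)/2 + i ≠ 0` when `cos(πλ/2) ≠ 0`. -/
lemma odd_factor_ne_zero {lam : ℝ} (hc : Real.cos (π * lam / 2) ≠ 0) (i : ℕ) :
    (1 - lam) / 2 + i ≠ 0 := by
  intro h
  apply hc
  have : lam = 2 * ((i : ℤ) : ℝ) + 1 := by push_cast; linarith
  rw [this]
  exact cos_pi_mul_odd_div_two i

/-- `(1 + λ)/2 + i ≠ 0` when `cos(πλ/2) ≠ 0`. -/
lemma odd_factor_ne_zero' {lam : ℝ} (hc : Real.cos (π * lam / 2) ≠ 0) (i : ℕ) :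
    (1 + lam) / 2 + i ≠ 0 := by
  intro h
  apply hc
  have : lam = 2 * ((-(i : ℤ) - 1 : ℤ) : ℝ) + 1 := by push_cast; linarith
  rw [this]
  exact cos_pi_mul_odd_div_two _

/-- `λ/2 + i ≠ 0` when `sin(πλ/2) ≠ 0`. -/
lemma even_factor_ne_zero {lam : ℝ} (hs : Real.sin (π * lam / 2) ≠ 0) (i : ℕ) :
    lam / 2 + i ≠ 0 := by
  intro h
  apply hs
  have : lam = 2 * ((-(i : ℤ) : ℤ) : ℝ) := by push_cast; linarith
  rw [this]
  exact sin_pi_mul_even_div_two _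

/-- `1 − λ/2 + i ≠ 0` when `sin(πλ/2) ≠ 0`. -/
lemma even_factor_ne_zero' {lam : ℝ} (hs : Real.sin (π * lam / 2) ≠ 0) (i : ℕ) :
    1 - lam / 2 + i ≠ 0 := by
  intro h
  apply hs
  have : lam = 2 * (((i : ℤ) + 1 : ℤ) : ℝ) := by push_cast; linarith
  rw [this]
  exact sin_pi_mul_even_div_two _

/-- `Γ((1 − λ)/2) Γ((1 + λ)/2) = π / cos(πλ/2)` (reflection at `z = (1 + λ)/2`). -/
lemma Gamma_mul_Gamma_eq_pi_div_cos (lam : ℝ) :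
    Real.Gamma ((1 - lam) / 2) * Real.Gamma ((1 + lam) / 2) = π / Real.cos (π * lam / 2) := by
  rw [show (1 - lam) / 2 = 1 - (1 + lam) / 2 by ring, mul_comm, Real.Gamma_mul_Gamma_one_sub,
    show π * ((1 + lam) / 2) = π * lam / 2 + π / 2 by ring, Real.sin_add_pi_div_two]

/-- `Γ(1 − λ/2) Γ(λ/2) = π / sin(πλ/2)` (reflection at `z = λ/2`). -/
lemma Gamma_mul_Gamma_eq_pi_div_sin (lam : ℝ) :
    Real.Gamma (1 - lam / 2) * Real.Gamma (lam / 2) = π / Real.sin (π * lam / 2) := by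
  rw [mul_comm, Real.Gamma_mul_Gamma_one_sub, show π * (lam / 2) = π * lam / 2 by ring]

section measure

variable [MeasurableSpace Circle] [BorelSpace Circle]

/-! ### Odd weights -/

/-- **Odd weights `k = 2j + 1`**: on the strip `1 − 2j < λ < 2j + 1`, away from the zeros of `cos(πλ/2)`,
`∫_G (1 − |g·0|²)^{k/2} φ_λ dν = 2^{2j−1} C_k/(2j − 1)! · π ∏_{i<j}((1−λ)/2 + i) ∏_{i<j−1}((1+λ)/2 + i) / cos(πλ/2)`
with `C_k = 4^j j!(j−1)!/(2j)!`. -/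
theorem integral_orbit_rpow_odd_mul_sph (j : ℕ) (hj : 1 ≤ j) {lam : ℝ}
    (h1 : 1 - 2 * (j : ℝ) < lam) (h2 : lam < 2 * j + 1) (hc : Real.cos (π * lam / 2) ≠ 0) :
    ∫ g, (1 - ‖orbit g‖ ^ 2) ^ (((2 * j + 1 : ℕ) : ℝ) / 2) * sph lam g ∂(nu haarCircle)
      = 2 ^ (2 * j - 1) * (4 ^ j * (j ! : ℝ) * ((j - 1)! : ℝ) / ((2 * j)! : ℝ)) / ((2 * j - 1)! : ℝ)
        * (π * (∏ i ∈ Finset.range j, ((1 - lam) / 2 + i))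
          * (∏ i ∈ Finset.range (j - 1), ((1 + lam) / 2 + i)))
        / Real.cos (π * lam / 2) := by
  have hj' : (1 : ℝ) ≤ j := by exact_mod_cast hj
  rw [integral_orbit_rpow_mul_sph (k := ((2 * j + 1 : ℕ) : ℝ)) (by push_cast; linarith)
    (by push_cast; linarith) (by push_cast; linarith), abel_const_odd j hj]
  have e0 : ((2 * j + 1 : ℕ) : ℝ) - 2 = ((2 * j - 1 : ℕ) : ℝ) := by
    rw [Nat.cast_sub (by omega)]; push_cast; ring
  have e1 : ((2 * j + 1 : ℕ) : ℝ) - 1 = ((2 * j - 1 : ℕ) : ℝ) + 1 := by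
    rw [Nat.cast_sub (by omega)]; push_cast; ring
  have e2 : (((2 * j + 1 : ℕ) : ℝ) - lam) / 2 = (1 - lam) / 2 + (j : ℝ) := by push_cast; ring
  have e3 : (((2 * j + 1 : ℕ) : ℝ) + lam) / 2 - 1 = (1 + lam) / 2 + ((j - 1 : ℕ) : ℝ) := by
    rw [Nat.cast_sub hj]; push_cast; ring
  rw [e0, Real.rpow_natCast, e1, Real.Gamma_nat_eq_factorial, e2,
    Gamma_add_nat _ j (fun i _ => odd_factor_ne_zero hc i), e3,
    Gamma_add_nat _ (j - 1) (fun i _ => odd_factor_ne_zero' hc i)]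
  have hrefl := Gamma_mul_Gamma_eq_pi_div_cos lam
  set P := ∏ i ∈ Finset.range j, ((1 - lam) / 2 + i)
  set Q := ∏ i ∈ Finset.range (j - 1), ((1 + lam) / 2 + i)
  set G1 := Real.Gamma ((1 - lam) / 2)
  set G2 := Real.Gamma ((1 + lam) / 2)
  have hF : (0 : ℝ) < ((2 * j - 1)! : ℝ) := by exact_mod_cast Nat.factorial_pos _
  rw [eq_div_iff hc]
  have hrefl' : G1 * G2 * Real.cos (π * lam / 2) = π := by
    rw [hrefl]; field_simp
  calc 2 ^ (2 * j - 1) * (4 ^ j * (j ! : ℝ) * ((j - 1)! : ℝ) / ((2 * j)! : ℝ))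
        * (P * G1 * (Q * G2) / ((2 * j - 1)! : ℝ)) * Real.cos (π * lam / 2)
      = 2 ^ (2 * j - 1) * (4 ^ j * (j ! : ℝ) * ((j - 1)! : ℝ) / ((2 * j)! : ℝ)) / ((2 * j - 1)! : ℝ)
          * (P * Q) * (G1 * G2 * Real.cos (π * lam / 2)) := by ring
    _ = _ := by rw [hrefl']; ring

/-- **The multiplied form on the whole strip**: `m̂_{2j+1}(λ) cos(πλ/2) = Q_j(λ)` for every
`1 − 2j < λ < 2j + 1` — at the zeros of the cosine both sides vanish (`Q_j` has the factor
`(1 − λ)/2 + i` or `(1 + λ)/2 + i` that vanishes there). -/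
theorem integral_orbit_rpow_odd_mul_sph_mul_cos (j : ℕ) (hj : 1 ≤ j) {lam : ℝ}
    (h1 : 1 - 2 * (j : ℝ) < lam) (h2 : lam < 2 * j + 1) :
    (∫ g, (1 - ‖orbit g‖ ^ 2) ^ (((2 * j + 1 : ℕ) : ℝ) / 2) * sph lam g ∂(nu haarCircle))
        * Real.cos (π * lam / 2)
      = 2 ^ (2 * j - 1) * (4 ^ j * (j ! : ℝ) * ((j - 1)! : ℝ) / ((2 * j)! : ℝ)) / ((2 * j - 1)! : ℝ)
        * (π * (∏ i ∈ Finset.range j, ((1 - lam) / 2 + i))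
          * (∏ i ∈ Finset.range (j - 1), ((1 + lam) / 2 + i))) := by
  by_cases hc : Real.cos (π * lam / 2) = 0
  · rw [hc, mul_zero]
    obtain ⟨n, hn⟩ := Real.cos_eq_zero_iff.mp hc
    have hlam : lam = 2 * n + 1 := by
      have hπ : π ≠ 0 := Real.pi_pos.ne'
      have : π * lam = π * (2 * n + 1) := by linarith
      exact mul_left_cancel₀ hπ this
    rcases le_or_gt 0 n with hn0 | hn0
    · -- `λ = 2n + 1` with `0 ≤ n < j`: the factor `i = n` of the first product vanishes
      obtain ⟨i, rfl⟩ : ∃ i : ℕ, (i : ℤ) = n := ⟨n.toNat, Int.toNat_of_nonneg hn0⟩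
      have hi : i < j := by
        have : (i : ℝ) < j := by push_cast at hlam; linarith
        exact_mod_cast this
      have hz : (1 - lam) / 2 + (i : ℝ) = 0 := by push_cast at hlam; rw [hlam]; ring
      rw [Finset.prod_eq_zero (Finset.mem_range.mpr hi) hz]
      ring
    · -- `λ = 2n + 1` with `n < 0`: the factor `i = −n − 1` of the second product vanishes
      obtain ⟨i, hi'⟩ : ∃ i : ℕ, (i : ℤ) = -n - 1 := ⟨(-n - 1).toNat, Int.toNat_of_nonneg (by omega)⟩
      have hiR : (i : ℝ) = -(n : ℝ) - 1 := by exact_mod_cast congrArg (fun z : ℤ => (z : ℝ)) hi'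
      have hi : i < j - 1 := by
        have : (i : ℝ) < (j : ℝ) - 1 := by rw [hiR]; linarith
        have : (i : ℝ) + 1 < j := by linarith
        have : i + 1 < j := by exact_mod_cast this
        omega
      have hz : (1 + lam) / 2 + (i : ℝ) = 0 := by rw [hiR, hlam]; ring
      rw [Finset.prod_eq_zero (Finset.mem_range.mpr hi) hz]
      ring
  · rw [integral_orbit_rpow_odd_mul_sph j hj h1 h2 hc, div_mul_cancel₀ _ hc]

/-! ### Even weights -/

/-- **Even weights `k = 2j`**: on the strip `2 − 2j < λ < 2j`, away from the zeros of `sin(πλ/2)`,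
`∫_G (1 − |g·0|²)^{k/2} φ_λ dν = 2^{2j−2} C_k/(2j − 2)! · π ∏_{i<j−1}(1 − λ/2 + i) ∏_{i<j−1}(λ/2 + i) / sin(πλ/2)`
with `C_k = π(2j−2)!/(4^{j−1}((j−1)!)²)`. -/
theorem integral_orbit_rpow_even_mul_sph (j : ℕ) (hj : 2 ≤ j) {lam : ℝ}
    (h1 : 2 - 2 * (j : ℝ) < lam) (h2 : lam < 2 * j) (hs : Real.sin (π * lam / 2) ≠ 0) :
    ∫ g, (1 - ‖orbit g‖ ^ 2) ^ (((2 * j : ℕ) : ℝ) / 2) * sph lam g ∂(nu haarCircle)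
      = 2 ^ (2 * j - 2) * (π * ((2 * j - 2)! : ℝ) / (4 ^ (j - 1) * ((j - 1)! : ℝ) ^ 2))
          / ((2 * j - 2)! : ℝ)
        * (π * (∏ i ∈ Finset.range (j - 1), (1 - lam / 2 + i))
          * (∏ i ∈ Finset.range (j - 1), (lam / 2 + i)))
        / Real.sin (π * lam / 2) := by
  have hj' : (2 : ℝ) ≤ j := by exact_mod_cast hj
  rw [integral_orbit_rpow_mul_sph (k := ((2 * j : ℕ) : ℝ)) (by push_cast; linarith)
    (by push_cast; linarith) (by push_cast; linarith), abel_const_even j hj]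
  have e0 : ((2 * j : ℕ) : ℝ) - 2 = ((2 * j - 2 : ℕ) : ℝ) := by
    rw [Nat.cast_sub (by omega)]; push_cast; ring
  have e1 : ((2 * j : ℕ) : ℝ) - 1 = ((2 * j - 2 : ℕ) : ℝ) + 1 := by
    rw [Nat.cast_sub (by omega)]; push_cast; ring
  have e2 : (((2 * j : ℕ) : ℝ) - lam) / 2 = 1 - lam / 2 + ((j - 1 : ℕ) : ℝ) := by
    rw [Nat.cast_sub (by omega)]; push_cast; ring
  have e3 : (((2 * j : ℕ) : ℝ) + lam) / 2 - 1 = lam / 2 + ((j - 1 : ℕ) : ℝ) := by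
    rw [Nat.cast_sub (by omega)]; push_cast; ring
  rw [e0, Real.rpow_natCast, e1, Real.Gamma_nat_eq_factorial, e2,
    Gamma_add_nat _ (j - 1) (fun i _ => even_factor_ne_zero' hs i), e3,
    Gamma_add_nat _ (j - 1) (fun i _ => even_factor_ne_zero hs i)]
  have hrefl := Gamma_mul_Gamma_eq_pi_div_sin lam
  set P := ∏ i ∈ Finset.range (j - 1), (1 - lam / 2 + i)
  set Q := ∏ i ∈ Finset.range (j - 1), (lam / 2 + i)
  set G1 := Real.Gamma (1 - lam / 2)
  set G2 := Real.Gamma (lam / 2)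
  have hF : (0 : ℝ) < ((2 * j - 2)! : ℝ) := by exact_mod_cast Nat.factorial_pos _
  rw [eq_div_iff hs]
  have hrefl' : G1 * G2 * Real.sin (π * lam / 2) = π := by
    rw [hrefl]; field_simp
  calc 2 ^ (2 * j - 2) * (π * ((2 * j - 2)! : ℝ) / (4 ^ (j - 1) * ((j - 1)! : ℝ) ^ 2))
        * (P * G1 * (Q * G2) / ((2 * j - 2)! : ℝ)) * Real.sin (π * lam / 2)
      = 2 ^ (2 * j - 2) * (π * ((2 * j - 2)! : ℝ) / (4 ^ (j - 1) * ((j - 1)! : ℝ) ^ 2))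
          / ((2 * j - 2)! : ℝ) * (P * Q) * (G1 * G2 * Real.sin (π * lam / 2)) := by ring
    _ = _ := by rw [hrefl']; ring

/-! ### Weights `5` and `6` -/

/-- **Weight 5**: `∫_G (1 − |g·0|²)^{5/2} φ_λ dν = 2π(1 − λ)(1 + λ)(3 − λ)/(9 cos(πλ/2))` for `−3 < λ < 5`
away from the zeros of the cosine. -/
theorem integral_orbit_rpow_five_mul_sph {lam : ℝ} (h1 : -3 < lam) (h2 : lam < 5)
    (hc : Real.cos (π * lam / 2) ≠ 0) :
    ∫ g, (1 - ‖orbit g‖ ^ 2) ^ ((5 : ℝ) / 2) * sph lam g ∂(nu haarCircle)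
      = 2 * π * (1 - lam) * (1 + lam) * (3 - lam) / (9 * Real.cos (π * lam / 2)) := by
  rw [show (5 : ℝ) / 2 = ((2 * 2 + 1 : ℕ) : ℝ) / 2 by norm_num,
    integral_orbit_rpow_odd_mul_sph 2 (by norm_num) (by push_cast; linarith) (by push_cast; linarith) hc]
  simp only [Finset.prod_range_succ, Finset.prod_range_zero, Nat.cast_zero, Nat.cast_one, add_zero]
  norm_num [Nat.factorial]
  field_simp
  ring

/-- `∫_G (1 − |g·0|²)^{5/2} dν = 2π/3` from the weight-5 formula at `λ = 0` (agreeing with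
`integral_orbit_rpow_nu`: `2π/(5 − 2)`). -/
theorem integral_orbit_rpow_five :
    ∫ g, (1 - ‖orbit g‖ ^ 2) ^ ((5 : ℝ) / 2) ∂(nu haarCircle) = 2 * π / 3 := by
  have h := integral_orbit_rpow_five_mul_sph (lam := 0) (by norm_num) (by norm_num)
    (by rw [mul_zero, zero_div, Real.cos_zero]; exact one_ne_zero)
  simp only [sph_zero, mul_one, mul_zero, zero_div, Real.cos_zero, sub_zero, add_zero] at h
  rw [h]
  ring

/-- **Weight 6**: `∫_G (1 − |g·0|²)^{3} φ_λ dν = π² λ(2 − λ)(2 + λ)(4 − λ)/(64 sin(πλ/2))` for `−4 < λ < 6`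
away from the zeros of the sine. -/
theorem integral_orbit_rpow_six_mul_sph {lam : ℝ} (h1 : -4 < lam) (h2 : lam < 6)
    (hs : Real.sin (π * lam / 2) ≠ 0) :
    ∫ g, (1 - ‖orbit g‖ ^ 2) ^ ((6 : ℝ) / 2) * sph lam g ∂(nu haarCircle)
      = π ^ 2 * lam * (2 - lam) * (2 + lam) * (4 - lam) / (64 * Real.sin (π * lam / 2)) := by
  rw [show (6 : ℝ) / 2 = ((2 * 3 : ℕ) : ℝ) / 2 by norm_num,
    integral_orbit_rpow_even_mul_sph 3 (by norm_num) (by push_cast; linarith) (by push_cast; linarith) hs]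
  simp only [Finset.prod_range_succ, Finset.prod_range_zero, Nat.cast_zero, Nat.cast_one, add_zero]
  norm_num [Nat.factorial]
  field_simp
  ring

/-- `∫_G (1 − |g·0|²)^{3} Ξ dν = 9π²/64` from the weight-6 formula at `λ = 1` (agreeing with
`T5SU11AbelConstInteger.integral_orbit_rpow_six_mul_sph_one`). -/
theorem integral_orbit_rpow_six_mul_sph_one' :
    ∫ g, (1 - ‖orbit g‖ ^ 2) ^ ((6 : ℝ) / 2) * sph 1 g ∂(nu haarCircle) = 9 * π ^ 2 / 64 := by
  rw [integral_orbit_rpow_six_mul_sph (by norm_num) (by norm_num)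
    (by rw [mul_one, Real.sin_pi_div_two]; exact one_ne_zero), show π * 1 / 2 = π / 2 by ring,
    Real.sin_pi_div_two]
  ring

/-- **Cross-check at the critical parameter**: the weight-5 formula at `λ = 1` is silent (`cos(π/2) = 0`),
but the multiplied form gives `m̂_5(1) · 0 = 0`, consistent with `m̂_5(1) = C_5² = 16/9`
(`integral_orbit_rpow_five_mul_sph_one`). -/
theorem integral_orbit_rpow_five_mul_sph_one_mul_cos :
    (∫ g, (1 - ‖orbit g‖ ^ 2) ^ ((5 : ℝ) / 2) * sph 1 g ∂(nu haarCircle)) * Real.cos (π * 1 / 2) = 0 := by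
  rw [integral_orbit_rpow_five_mul_sph_one, mul_one, Real.cos_pi_div_two, mul_zero]

end measure

end Summit.Ventures.HodgeRepro2.T5SU11JacobiIntegerWeight
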